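/-
Copyright (c) 2026 the pub-hodgecm-mathlib formalisation cell (harness21).  Prover seat hodgecm-mathlib-R90-C131-p01 (g3), R90-TF section S6 «Ch. 14.1–14.5 stable trace
formula» (h413 = `stmt-HodgeConjecture-24833`), S6 dealer R90-C14-plan (g3) (RULINGS #9: «(T4.4) is the natural next for your hands»): CARD (T4.4) «THE ELLIPTIC APARTMENT
DICTIONARY IN AN ORTHOGONAL EIGENFRAME» = target (T4.4) of typ2 (g3)'s SHEET v2.2 `R90/R90-C14-typ2/g3/S6_T4_TwistedEllipticCount_Targets.v2.lean` (58d0b56434f3ab26) §3 :207,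
statement VERBATIM.  THEOREMS ONLY (no `def`, no `instance`, no notation, no named-fact hypothesis, no `sorry`); ★-only imports, NO `Lines` import, NO sheet import.
-/
import Summits.HodgeConjecture.HodgeConjecture.Theorems.R90S6ApartmentTwistedShell   -- ★ TL4: (A.2) `diagonalGL_mem_doubleCoset_iff_exists_perm`; brings ★ L1∕J2′ `mul_mul_mem_doubleCoset_iff`, `inv_mul_mem_doubleCoset_iff_relPos_eq`, ★ `relPos`, `antitone_relPos`, ★ `qsInvolution_zpowDiagGL`
import Literature.NumberTheory.Automorphic.UnitaryGroupFormTransport                  -- ★ `formCongr` (Gram matrix `ᵗ(σT)·H·T` in a frame)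
import Literature.NumberTheory.Automorphic.HeckeIntegrandPureTensorDualOnBox            -- ★ `weylLong_mem_glInt`
import Literature.NumberTheory.Automorphic.BigBruhatCellChart                           -- ★ `weylLong_inv`, `weylLong_mul_weylLong`
import Literature.NumberTheory.Automorphic.CuspidalContragredientInfinityType           -- ★ `coe_weylLong_mul_mul_coe_weylLong_apply` (`(w⁰ M w⁰)_{ij} = M_{rev i, rev j}`)
import HarnessLib

/-!
# R90-TF · S6 «Ch. 14.1–14.5», (T4.4) THE ELLIPTIC APARTMENT DICTIONARY IN AN ORTHOGONAL EIGENFRAME: `τ_{δ′}` is the point reflection `n ↦ (c − e) − n` of `A_T`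
# (Kottwitz 1986 §1 pp. 240–242, §3; Macdonald 1995 Ch. V §2 (2.2), (2.6); Rogawski 1990 §1.9–§1.10, §4.10)

Cell `hodgecm-mathlib`, crux H413 (`stmt-HodgeConjecture-24833`, lane `--supports … --as helper`), route of record `HCCMUnconditional` (no route verbs;
count-neutral).  Programme R90-TF, section S6, DAG row E1.4.4.2.2 (the `G̃`-side twisted shell counts `#Shell(δ′, a)` at an elliptic `G`-regular norm); S6 dealer
R90-C14-plan (g3); SPEC AUTHORITY typ2 (g3) (TARGET SHEET v2.2 58d0b56434f3ab26 §3 :207 `relPos_eigenFrame_zpowDiagGL_twistFrame_eq_iff`).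

THE MATHEMATICS.  `K` a discretely valued field (`Valued K ℤᵐ⁰`, compatible `ValuativeRel`, DVR integers), `ϖ` a uniformiser, `K̃ = GL_N(𝒪)`, `σ` valuation-preserving with
`σ ϖ = ϖ`, `Θ_σ(g) = w⁰·ᵗ(σg)⁻¹·w⁰` (★ `UnitaryGroup.qsInvolution`), `J₀ = w⁰` the antidiagonal form.  An (orthogonal) EIGENFRAME of `δ′` is a `g ∈ GL_N(K)` with
`g⁻¹δ′g = diag(d)` and DIAGONAL Gram matrix `ᵗ(σg)·J₀·g = diag(u)` (★ `formCongr`; the eigenlines of an elliptic `G`-regular norm are pairwise `Φ`-orthogonal).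
* §1 `qsInvolution_eq_of_formCongr_eq_diagonal`: in such a frame **`Θ_σ(g) = g · diag(u)⁻¹ · w⁰`** (from `ᵗ(σg) = diag(u)·g⁻¹·w⁰` and `(w⁰)² = 1`).
* §2 `weylLong_mul_diagonalGL`: `w⁰ · diag(v) = diag(v ∘ rev) · w⁰` (★ `coe_weylLong_mul_mul_coe_weylLong_apply`).
* §3 `inv_mul_mul_qsInvolution_eigenFrame_zpowDiagGL`: for the apartment vertex `x = g·ϖ^n` of the torus `T = g·D·g⁻¹`,
  **`x⁻¹ · δ′ · Θ_σ(x) = diag(ϖ^{−n} · d · u⁻¹ · ϖ^{−n}) · w⁰`** (★ `qsInvolution_mul`, §1, ★ `qsInvolution_zpowDiagGL`, §2).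
* §4 **`relPos_eigenFrame_zpowDiagGL_twistFrame_eq_iff`** (THE HEAD, sheet bytes): `relPos hϖ (g·ϖ^n) (δ′·Θ_σ(g·ϖ^n)) = λ ⟺ λ antitone ∧ (c − e − 2n) ~ λ` where
  `v(d_i) = v(ϖ^{c_i})`, `v(u_i) = v(ϖ^{e_i})` — `w⁰ ∈ K̃` (★ `weylLong_mem_glInt`) drops out of the Cartan shell (★ L1 `mul_mul_mem_doubleCoset_iff`), the diagonal part lies in
  `K̃ϖ^λK̃` iff its valuation vector `c − e − 2n` is a permutation of `λ` (★ TL4 (A.2) `diagonalGL_mem_doubleCoset_iff_exists_perm`), and membership reads as `relPos = λ` for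
  antitone `λ` (★ L1 `inv_mul_mem_doubleCoset_iff_relPos_eq`).  I.e. `τ_{δ′}` acts on the apartment `A_T ≅ ℤ^N` as the POINT REFLECTION `n ↦ (c − e) − n` and
  `inv(Λ_n, τ_{δ′}Λ_n) = sort↓(c − e − 2n)` (★ TL4 (A.3′) is the case `g = 1`, `u = 1`).
HONEST LABEL: apartment-level dictionary (pure `GL_N` algebra over a discretely valued field), count-neutral until the E1.4.4.2.2 counts consume it; HC_CM is proved only
modulo the 7 printed citations (2 remaining named inputs: hLiu418 = stmt-HodgeConjecture-24832, h413 = stmt-HodgeConjecture-24833) until rung 0 closes; REL ≠ ★ ≠ BUILT.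

## References
* [Kottwitz1986BaseChangeUnits] R. E. Kottwitz, *Base change for unit elements of Hecke algebras*, Compositio Math. 60 (1986), §1 pp. 240–242, §3 (the apartment ∕ torus
  computation of twisted orbital integrals of units).
* [Macdonald1995] I. G. Macdonald, *Symmetric Functions and Hall Polynomials*, 2nd ed. (1995), Ch. V §2 (2.2), (2.6) (Cartan double cosets, relative position).
* [Rogawski1990] J. D. Rogawski, *Automorphic Representations of Unitary Groups in Three Variables*, Ann. of Math. Stud. 123 (1990), §1.9–§1.10 pp. 8–9 (`Θ`, `w⁰`),
  §4.10 pp. 57–58 (twisted orbital integrals).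
-/

set_option autoImplicit false
-- the mandated namespace repeats the single-problem summit's segment (`HodgeConjecture.HodgeConjecture`)
set_option linter.dupNamespace false

noncomputable section

open scoped Valued WithZero Matrix MatrixGroups Pointwise
open Literature.NumberTheory.Automorphic Literature.NumberTheory.Automorphic.HermitianLattice Literature.NumberTheory.Automorphic.UnitaryLatticeTree

namespace Summit.HodgeConjecture.HodgeConjecture.R90.S6

/-! ## §1 `Θ_σ` in an orthogonal frame; §2 `w⁰` against the diagonal torus -/

section Frame

variable {K : Type*} [Field K] {σ : K →+* K} {N : ℕ}

/-- **`Θ_σ(g) = g · diag(u)⁻¹ · w⁰` IN AN ORTHOGONAL FRAME**: if the Gram matrix of the antidiagonal form `J₀ = w⁰` in the frame `g` is diagonal, `ᵗ(σg)·J₀·g = diag(u)`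
(★ `formCongr`), then `ᵗ(σg)⁻¹ = w⁰·g·diag(u)⁻¹` (`ᵗ(σg)·(w⁰ g diag(u)⁻¹) = diag(u)·diag(u)⁻¹ = 1`) and `Θ_σ(g) = w⁰·ᵗ(σg)⁻¹·w⁰ = g·diag(u)⁻¹·w⁰` (`(w⁰)² = 1`).
[cite: Rogawski1990, §1.9–§1.10 pp. 8–9] -/
theorem qsInvolution_eq_of_formCongr_eq_diagonal {g : GL (Fin N) K} {u : Fin N → Kˣ}
    (hu : formCongr σ g ((StdForm.antidiagonal N).over K) = Matrix.diagonal fun i => (u i : K)) :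
    UnitaryGroup.qsInvolution σ g = g * (diagonalGL (Fin N) K u)⁻¹ * weylLong N K := by
  -- matrices: `W = w⁰`, `A = σ g`, `D = diag u`
  have hWW : ((weylLong N K : GL (Fin N) K) : Matrix (Fin N) (Fin N) K) * ((weylLong N K : GL (Fin N) K) : Matrix (Fin N) (Fin N) K) = 1 :=
    weylLong_mul_weylLong
  have hu' : (((g : GL (Fin N) K) : Matrix (Fin N) (Fin N) K).map σ)ᵀ * ((weylLong N K : GL (Fin N) K) : Matrix (Fin N) (Fin N) K) *
      ((g : GL (Fin N) K) : Matrix (Fin N) (Fin N) K) = ((diagonalGL (Fin N) K u : GL (Fin N) K) : Matrix (Fin N) (Fin N) K) := by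
    rw [coe_diagonalGL, ← hu, formCongr, UnitaryGroup.antidiagonal_over_eq_coe_weylLong]
  -- `ᵗ(σg)⁻¹ = w⁰ · g · diag(u)⁻¹`
  have hA : (((g : GL (Fin N) K) : Matrix (Fin N) (Fin N) K).map σ)ᵀ *
      (((weylLong N K : GL (Fin N) K) : Matrix (Fin N) (Fin N) K) * ((g : GL (Fin N) K) : Matrix (Fin N) (Fin N) K) *
        (((diagonalGL (Fin N) K u : GL (Fin N) K) : Matrix (Fin N) (Fin N) K))⁻¹) = 1 := by
    rw [← Matrix.mul_assoc, ← Matrix.mul_assoc, hu', Matrix.mul_nonsing_inv _ (Matrix.isUnits_det_units _)]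
  have hinv : ((((g : GL (Fin N) K) : Matrix (Fin N) (Fin N) K).map σ)ᵀ)⁻¹ =
      ((weylLong N K : GL (Fin N) K) : Matrix (Fin N) (Fin N) K) * ((g : GL (Fin N) K) : Matrix (Fin N) (Fin N) K) *
        (((diagonalGL (Fin N) K u : GL (Fin N) K) : Matrix (Fin N) (Fin N) K))⁻¹ :=
    Matrix.inv_eq_right_inv hA
  refine Units.ext ?_
  rw [UnitaryGroup.coe_qsInvolution, Matrix.transpose_nonsing_inv, hinv, Units.val_mul, Units.val_mul, Matrix.coe_units_inv]
  calc ((weylLong N K : GL (Fin N) K) : Matrix (Fin N) (Fin N) K) *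
        (((weylLong N K : GL (Fin N) K) : Matrix (Fin N) (Fin N) K) * ((g : GL (Fin N) K) : Matrix (Fin N) (Fin N) K) *
          (((diagonalGL (Fin N) K u : GL (Fin N) K) : Matrix (Fin N) (Fin N) K))⁻¹) * ((weylLong N K : GL (Fin N) K) : Matrix (Fin N) (Fin N) K)
      = (((weylLong N K : GL (Fin N) K) : Matrix (Fin N) (Fin N) K) * ((weylLong N K : GL (Fin N) K) : Matrix (Fin N) (Fin N) K)) *
          ((g : GL (Fin N) K) : Matrix (Fin N) (Fin N) K) * (((diagonalGL (Fin N) K u : GL (Fin N) K) : Matrix (Fin N) (Fin N) K))⁻¹ *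
            ((weylLong N K : GL (Fin N) K) : Matrix (Fin N) (Fin N) K) := by
        simp only [Matrix.mul_assoc]
    _ = ((g : GL (Fin N) K) : Matrix (Fin N) (Fin N) K) * (((diagonalGL (Fin N) K u : GL (Fin N) K) : Matrix (Fin N) (Fin N) K))⁻¹ *
          ((weylLong N K : GL (Fin N) K) : Matrix (Fin N) (Fin N) K) := by
        rw [hWW, Matrix.one_mul]

/-- **`w⁰ · diag(v) = diag(v ∘ rev) · w⁰`**: the long Weyl element normalises the diagonal torus, reversing the order of the entries (★ `coe_weylLong_mul_mul_coe_weylLong_apply`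
`(w⁰ M w⁰)_{ij} = M_{rev i, rev j}` and `(w⁰)² = 1`). [cite: Rogawski1990, §1.10 p. 9] -/
theorem weylLong_mul_diagonalGL (v : Fin N → Kˣ) :
    weylLong N K * diagonalGL (Fin N) K v = diagonalGL (Fin N) K (fun i => v (Fin.rev i)) * weylLong N K := by
  have hWW : weylLong N K * weylLong N K = 1 := by
    have h := mul_inv_cancel (weylLong N K)
    rwa [weylLong_inv] at h
  -- `w⁰ · diag(v) · w⁰ = diag(v ∘ rev)`
  have hconj : weylLong N K * diagonalGL (Fin N) K v * weylLong N K = diagonalGL (Fin N) K (fun i => v (Fin.rev i)) := by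
    refine Matrix.GeneralLinearGroup.ext fun i j => ?_
    rw [Units.val_mul, Units.val_mul, coe_weylLong_mul_mul_coe_weylLong_apply, coe_diagonalGL, coe_diagonalGL, Matrix.diagonal_apply,
      Matrix.diagonal_apply]
    by_cases hij : i = j
    · subst hij
      rw [if_pos rfl, if_pos rfl]
    · rw [if_neg (fun h => hij (Fin.rev_injective h)), if_neg hij]
  calc weylLong N K * diagonalGL (Fin N) K v = weylLong N K * diagonalGL (Fin N) K v * (weylLong N K * weylLong N K) := by rw [hWW, mul_one]
    _ = weylLong N K * diagonalGL (Fin N) K v * weylLong N K * weylLong N K := by rw [← mul_assoc]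
    _ = diagonalGL (Fin N) K (fun i => v (Fin.rev i)) * weylLong N K := by rw [hconj]

end Frame

/-! ## §3 The twisted position of an apartment vertex of `T = g·D·g⁻¹`, explicitly; §4 the HEAD -/

section Apartment

variable {K : Type} [Field K] [Valued K ℤᵐ⁰] [ValuativeRel K] [(Valued.v : Valuation K ℤᵐ⁰).Compatible] {σ : K →+* K} {N : ℕ}
  [IsDiscreteValuationRing (ValuativeRel.valuation K).integer] {ϖ : K} (hϖ : IsUniformizingElement ϖ)

omit [Valued K ℤᵐ⁰] [(Valued.v : Valuation K ℤᵐ⁰).Compatible] [IsDiscreteValuationRing (ValuativeRel.valuation K).integer] in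
/-- **THE TWISTED POSITION OF AN APARTMENT VERTEX IN THE EIGENFRAME, EXPLICITLY**: with `g⁻¹δ′g = diag(d)`, `ᵗ(σg)·J₀·g = diag(u)`, `σ ϖ = ϖ` and `x = g·ϖ^n`:
`x⁻¹ · δ′ · Θ_σ(x) = diag(ϖ^{−n_i} · d_i · u_i⁻¹ · ϖ^{−n_i}) · w⁰` (★ `qsInvolution_mul`, §1, ★ `qsInvolution_zpowDiagGL` `Θ_σ(ϖ^n) = ϖ^{−w₀n}`, §2).
[cite: Kottwitz1986BaseChangeUnits, §3] [cite: Rogawski1990, §4.10 p. 58] -/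
theorem inv_mul_mul_qsInvolution_eigenFrame_zpowDiagGL (hσϖ : σ ϖ = ϖ) {g δ' : GL (Fin N) K} {d u : Fin N → Kˣ}
    (hδ : g⁻¹ * δ' * g = diagonalGL (Fin N) K d)
    (hu : formCongr σ g ((StdForm.antidiagonal N).over K) = Matrix.diagonal fun i => (u i : K)) (n : Fin N → ℤ) :
    (g * zpowDiagGL hϖ.ne_zero n)⁻¹ * (δ' * UnitaryGroup.qsInvolution σ (g * zpowDiagGL hϖ.ne_zero n)) =
      diagonalGL (Fin N) K (fun i => (Units.mk0 ϖ hϖ.ne_zero ^ n i)⁻¹ * d i * (u i)⁻¹ * Units.mk0 ϖ hϖ.ne_zero ^ (-n i)) * weylLong N K := by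
  have hP : zpowDiagGL hϖ.ne_zero n = diagonalGL (Fin N) K (fun i => Units.mk0 ϖ hϖ.ne_zero ^ n i) := rfl
  have hP' : zpowDiagGL hϖ.ne_zero (fun i => -n (Fin.rev i)) = diagonalGL (Fin N) K (fun i => Units.mk0 ϖ hϖ.ne_zero ^ (-n (Fin.rev i))) := rfl
  rw [UnitaryGroup.qsInvolution_mul, qsInvolution_eq_of_formCongr_eq_diagonal hu, qsInvolution_zpowDiagGL hϖ.ne_zero hσϖ n, hP', hP]
  calc (g * diagonalGL (Fin N) K (fun i => Units.mk0 ϖ hϖ.ne_zero ^ n i))⁻¹ *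
        (δ' * (g * (diagonalGL (Fin N) K u)⁻¹ * weylLong N K * diagonalGL (Fin N) K (fun i => Units.mk0 ϖ hϖ.ne_zero ^ (-n (Fin.rev i)))))
      = (diagonalGL (Fin N) K (fun i => Units.mk0 ϖ hϖ.ne_zero ^ n i))⁻¹ * (g⁻¹ * δ' * g) * (diagonalGL (Fin N) K u)⁻¹ *
          (weylLong N K * diagonalGL (Fin N) K (fun i => Units.mk0 ϖ hϖ.ne_zero ^ (-n (Fin.rev i)))) := by
        simp only [mul_inv_rev, mul_assoc]
    _ = (diagonalGL (Fin N) K (fun i => Units.mk0 ϖ hϖ.ne_zero ^ n i))⁻¹ * diagonalGL (Fin N) K d * (diagonalGL (Fin N) K u)⁻¹ *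
          (diagonalGL (Fin N) K (fun i => Units.mk0 ϖ hϖ.ne_zero ^ (-n (Fin.rev (Fin.rev i)))) * weylLong N K) := by
        rw [hδ, weylLong_mul_diagonalGL]
    _ = diagonalGL (Fin N) K (fun i => (Units.mk0 ϖ hϖ.ne_zero ^ n i)⁻¹ * d i * (u i)⁻¹ * Units.mk0 ϖ hϖ.ne_zero ^ (-n i)) * weylLong N K := by
        rw [← mul_assoc, ← map_inv, ← map_inv, ← map_mul, ← map_mul, ← map_mul]
        congr 2
        funext i
        simp only [Pi.mul_apply, Pi.inv_apply, Fin.rev_rev]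

/-- **(T4.4) THE ELLIPTIC APARTMENT DICTIONARY** (★ TL4 (A.3′) transported to an `E`-frame; SHEET v2.2 §3 :207 VERBATIM).  Let `g ∈ GL_N(K)` be a frame with `g⁻¹δ′g = diag(d)`
(so `δ′ ∈ T(E) = g·D·g⁻¹`, type (1)) whose Gram matrix for `J₀` is DIAGONAL, `ᵗ(σg)·J₀·g = diag(u)` (the eigenlines of an elliptic regular `γ ∈ U` are pairwise `Φ`-orthogonal), and
`v(d_i) = v(ϖ^{c_i})`, `v(u_i) = v(ϖ^{e_i})`.  Then for the split lattice `Λ_n = g·ϖ^n·𝒪^N`: `relPos hϖ (g·ϖ^n) (δ′·Θ_σ(g·ϖ^n)) = λ ⟺ λ antitone ∧ (c − e − 2n) ~ λ` — by §3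
the twisted position is `diag(ϖ^{−n} d u⁻¹ ϖ^{−n})·w⁰`, the factor `w⁰ ∈ K̃` (★ `weylLong_mem_glInt`) drops out of the Cartan shell `K̃ϖ^λK̃` (★ L1 `mul_mul_mem_doubleCoset_iff`), the
diagonal part has valuation vector `c − e − 2n` (`hvσ`-free: `σ ϖ = ϖ` already fixed `Θ_σ(ϖ^n)`), so it lies in `K̃ϖ^λK̃` iff `c − e − 2n` is a permutation of `λ` (★ TL4 (A.2)
`diagonalGL_mem_doubleCoset_iff_exists_perm`), and for antitone `λ` shell membership is `relPos = λ` (★ L1 `inv_mul_mem_doubleCoset_iff_relPos_eq`; `relPos` is antitone, ★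
`antitone_relPos`).  I.e. `τ_{δ′}` acts on the apartment `A_T ≅ ℤ^N` as the POINT REFLECTION `n ↦ (c − e) − n` and `inv(Λ_n, τΛ_n) = sort↓(c − e − 2n)`.
The sheet's binder `hvσ` («`σ` isometric») is kept for the spec's arity but is NOT used (`_hvσ`): in an orthogonal eigenframe only `σ ϖ = ϖ` enters, through `Θ_σ(ϖ^n) = ϖ^{−w₀n}`.
[cite: Kottwitz1986BaseChangeUnits, §1 pp. 240–242, §3] [cite: Macdonald1995, Ch. V §2 (2.2), (2.6)] -/
theorem relPos_eigenFrame_zpowDiagGL_twistFrame_eq_iff (_hvσ : ∀ a, Valued.v (σ a) = Valued.v a) (hσϖ : σ ϖ = ϖ)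
    {g δ' : GL (Fin N) K} {d u : Fin N → Kˣ} {c e : Fin N → ℤ}
    (hδ : g⁻¹ * δ' * g = diagonalGL (Fin N) K d)
    (hu : formCongr σ g ((StdForm.antidiagonal N).over K) = Matrix.diagonal fun i => (u i : K))
    (hd : ∀ i, Valued.v (d i : K) = Valued.v (ϖ ^ c i)) (he : ∀ i, Valued.v (u i : K) = Valued.v (ϖ ^ e i)) (n la : Fin N → ℤ) :
    relPos hϖ (g * zpowDiagGL hϖ.ne_zero n) (δ' * UnitaryGroup.qsInvolution σ (g * zpowDiagGL hϖ.ne_zero n)) = la ↔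
      Antitone la ∧ ∃ π : Equiv.Perm (Fin N), ∀ i, c (π i) - e (π i) - 2 * n (π i) = la i := by
  have hv0 : Valued.v ϖ ≠ 0 := (Valuation.ne_zero_iff _).2 hϖ.ne_zero
  -- the valuation vector of the diagonal part is `c − e − 2n`
  have hw : ∀ i, Valued.v (((Units.mk0 ϖ hϖ.ne_zero ^ n i)⁻¹ * d i * (u i)⁻¹ * Units.mk0 ϖ hϖ.ne_zero ^ (-n i) : Kˣ) : K) =
      Valued.v (ϖ ^ (c i - e i - 2 * n i)) := by
    intro i
    rw [Units.val_mul, Units.val_mul, Units.val_mul, Units.val_inv_eq_inv_val, Units.val_inv_eq_inv_val, Units.val_zpow_eq_zpow_val,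
      Units.val_zpow_eq_zpow_val, Units.val_mk0, map_mul, map_mul, map_mul, map_inv₀, map_inv₀, hd, he, map_zpow₀, map_zpow₀, map_zpow₀,
      map_zpow₀, map_zpow₀, ← zpow_neg, ← zpow_neg, ← zpow_add₀ hv0, ← zpow_add₀ hv0, ← zpow_add₀ hv0]
    congr 1
    ring
  -- shell membership of the twisted position ⟺ of its diagonal part ⟺ `c − e − 2n ~ λ`
  have hmem : (g * zpowDiagGL hϖ.ne_zero n)⁻¹ * (δ' * UnitaryGroup.qsInvolution σ (g * zpowDiagGL hϖ.ne_zero n)) ∈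
        (glInt N K : Set (GL (Fin N) K)) * {zpowDiagGL hϖ.ne_zero la} * (glInt N K : Set (GL (Fin N) K)) ↔
      ∃ π : Equiv.Perm (Fin N), ∀ i, c (π i) - e (π i) - 2 * n (π i) = la i := by
    rw [inv_mul_mul_qsInvolution_eigenFrame_zpowDiagGL hϖ hσϖ hδ hu n, ← one_mul (diagonalGL (Fin N) K _),
      mul_mul_mem_doubleCoset_iff (zpowDiagGL hϖ.ne_zero la) (glInt N K).one_mem (weylLong_mem_glInt N),
      diagonalGL_mem_doubleCoset_iff_exists_perm hϖ (e := fun i => c i - e i - 2 * n i) hw la]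
  constructor
  · intro h
    have hla : Antitone la := h ▸ antitone_relPos hϖ _ _
    exact ⟨hla, hmem.1 ((inv_mul_mem_doubleCoset_iff_relPos_eq hϖ hla _ _).2 h)⟩
  · rintro ⟨hla, hπ⟩
    exact (inv_mul_mem_doubleCoset_iff_relPos_eq hϖ hla _ _).1 (hmem.2 hπ)

end Apartment

end Summit.HodgeConjecture.HodgeConjecture.R90.S6

end
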